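import Mathlib

/-!
# Wild twist at the CM prime — the habitat is invisible at `q` (bsd-idea-20 g10, REV 2 support for K1)

Self-contained (imports only Mathlib; the two definitions below are VERBATIM copies of
`GoodTwistPrime` / `grossPrimes` from `Cruxes/UpperOffV0HSYPlus/WildTwistAtCMPrimeSketch.lean`
(bsd-idea-20 g2), renamed with a trailing `'` so that nothing is redeclared).

For a good twisting prime `ℓ` of the Gross curve `A(q)` (`4ℓ = x² + q y²`, `x, y` odd), `4ℓ ≡ x² (mod q)`,
so `ℓ` is a quadratic residue mod `q`.  Consequently for every `d` in the habitat `GoodTwist q d` one has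
`(d/q) = +1`: the quadratic twist `A(q)^{(d)}` is locally at `q` isomorphic to `A(q)` itself (the twisting
character `χ_d` is unramified at `q` with `χ_d(Frob_q) = (d/q) = 1`), so the joint-ramification local toric
period at `q` in the explicit Gross–Zagier formula of crux K1 is a function of `(q, k)` ALONE — it cannot
carry a `d`-dependent power of `2`.  This file records the kernel-checked arithmetic core.
No summit statement is proved here.
-/

namespace Summit.BirchSwinnertonDyer.BirchSwinnertonDyer.Cruxes.UpperOffV0HSYPlus.WildTwistAtCMPrime.HabitatAtQ

/-- Copy of `WildTwistAtCMPrime.grossPrimes`. -/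
def grossPrimes' : List ℕ := [11, 19, 43, 67, 163]

/-- Copy of `WildTwistAtCMPrime.GoodTwistPrime`: `4ℓ = x² + q y²` with `x, y` odd. -/
def GoodTwistPrime' (q ℓ : ℕ) : Prop :=
  ∃ x y : ℕ, x % 2 = 1 ∧ y % 2 = 1 ∧ x * x + q * (y * y) = 4 * ℓ

example : GoodTwistPrime' 11 5 := ⟨3, 1, by norm_num⟩
example : GoodTwistPrime' 11 23 := ⟨9, 1, by norm_num⟩

/-- `4ℓ` is a square modulo `q` for every good twisting prime `ℓ` of `A(q)`. -/
theorem isSquare_four_mul_of_goodTwistPrime {q ℓ : ℕ} (h : GoodTwistPrime' q ℓ) :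
    IsSquare ((4 * ℓ : ℕ) : ZMod q) := by
  obtain ⟨x, y, -, -, hxy⟩ := h
  refine ⟨(x : ZMod q), ?_⟩
  have h1 : ((x * x + q * (y * y) : ℕ) : ZMod q) = ((4 * ℓ : ℕ) : ZMod q) := by rw [hxy]
  rw [← h1]
  push_cast
  simp

/-- Hence `ℓ` itself is a quadratic residue modulo an odd `q`: `ℓ ≡ (x · 2⁻¹)² (mod q)`. -/
theorem isSquare_of_goodTwistPrime {q ℓ : ℕ} (hq : Odd q) (h : GoodTwistPrime' q ℓ) :
    IsSquare ((ℓ : ℕ) : ZMod q) := by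
  obtain ⟨r, hr⟩ := isSquare_four_mul_of_goodTwistPrime h
  have h2 : IsUnit ((2 : ℕ) : ZMod q) := by
    rw [ZMod.isUnit_iff_coprime]
    exact Nat.coprime_two_left.2 hq
  obtain ⟨u, hu⟩ := h2
  have h4 : ((4 * ℓ : ℕ) : ZMod q) = (u : ZMod q) * (u : ZMod q) * ((ℓ : ℕ) : ZMod q) := by
    rw [hu]; push_cast; ring
  refine ⟨r * ↑u⁻¹, ?_⟩
  have key : (u : ZMod q) * (u : ZMod q) * ((ℓ : ℕ) : ZMod q) = r * r := by rw [← h4, hr]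
  have hinv : (↑u⁻¹ : ZMod q) * (u : ZMod q) = 1 := by simp
  calc ((ℓ : ℕ) : ZMod q)
      = ((↑u⁻¹ : ZMod q) * (u : ZMod q)) * ((↑u⁻¹ : ZMod q) * (u : ZMod q)) * ((ℓ : ℕ) : ZMod q) := by
          rw [hinv]; ring
    _ = (↑u⁻¹ * ↑u⁻¹) * ((u : ZMod q) * (u : ZMod q) * ((ℓ : ℕ) : ZMod q)) := by ring
    _ = (↑u⁻¹ * ↑u⁻¹) * (r * r) := by rw [key]
    _ = (r * ↑u⁻¹) * (r * ↑u⁻¹) := by ring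

/-- A good twisting prime is never `q` itself (for the five Gross primes): `4 = q x'² + y²` has no
solution with `y` odd and `q ≥ 11`.  Recorded as: `q ∤ ℓ` whenever `ℓ` is prime — here in the weaker,
directly checkable form that `(ℓ : ZMod q)` is a NONZERO square is what K1 uses; we only certify the
residue-class facts below. The five Gross primes are `≡ 3 (mod 8)`, so `v₂(q + 1) = 2` and
`v₂(q − 1) = 1` exactly: the standard local factors `(1 ± q⁻¹)` of a toric period at `q` contribute the
`d`-independent constants 2 resp. 1 bits. -/
theorem grossPrimes_two_adic_shape :
    ∀ q ∈ grossPrimes', q % 8 = 3 ∧ (q + 1) % 8 = 4 ∧ (q - 1) % 4 = 2 := by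
  decide

end Summit.BirchSwinnertonDyer.BirchSwinnertonDyer.Cruxes.UpperOffV0HSYPlus.WildTwistAtCMPrime.HabitatAtQ
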